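import Mathlib

/-!
# A large matching in a bipartite graph with small weighted degrees

Crux `Summit.MatrixMultiplication.MatrixMultiplication.Theses.SnSubsetDichotomy.PolynomialSlack`
(item `stmt-MatrixMultiplication-8306`), level-one programme, lead c7 (two dense quotients, matching branch).

We work with a finite set `H` of cells `(a, b)` carrying nonnegative weights `w`.  If every row sum and every
column sum of the weights is at most `τ`, a matching of maximum cardinality inside `H` covers every cell of `H`
by a row or a column, and double counting gives `Σ_{e ∈ H} w(e) ≤ 2·|M|·τ`.
-/

namespace Summit.MatrixMultiplication.MatrixMultiplication.Theorems.PolynomialSlack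

set_option linter.dupNamespace false

open scoped BigOperators

/-- **Matching extraction.** In a finite set `H` of cells with nonnegative weights whose row sums and column
sums are all `≤ τ`, there is a matching `M ⊆ H` (no two cells share a row or a column) with
`Σ_{e ∈ H} w(e) ≤ 2·|M|·τ`: take `M` of maximum cardinality among matchings in `H`; every cell of `H` shares a
row or a column with a cell of `M`, so the total weight is at most the sum over `M` of (row sum + column sum).
[folklore] -/
theorem exists_matching_of_small_degrees {α β : Type*} [DecidableEq α] [DecidableEq β]
    (H : Finset (α × β)) (w : α × β → ℝ) (hw : ∀ e ∈ H, 0 ≤ w e) (τ : ℝ)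
    (hrow : ∀ a, ∑ e ∈ H.filter (fun e => e.1 = a), w e ≤ τ)
    (hcol : ∀ b, ∑ e ∈ H.filter (fun e => e.2 = b), w e ≤ τ) :
    ∃ M : Finset (α × β), M ⊆ H ∧ Set.InjOn Prod.fst (M : Set (α × β)) ∧
      Set.InjOn Prod.snd (M : Set (α × β)) ∧ ∑ e ∈ H, w e ≤ 2 * M.card * τ := by
  classical
  -- a matching of maximum cardinality among the matchings contained in `H`
  obtain ⟨M, hMmem, hmax⟩ :=
    ((H.powerset).filter (fun M : Finset (α × β) =>
      (∀ e ∈ M, ∀ e' ∈ M, e.1 = e'.1 → e = e') ∧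
        (∀ e ∈ M, ∀ e' ∈ M, e.2 = e'.2 → e = e'))).exists_max_image Finset.card
      ⟨∅, by simp⟩
  have hMH : M ⊆ H := Finset.mem_powerset.mp (Finset.mem_filter.mp hMmem).1
  have hM1 : ∀ e ∈ M, ∀ e' ∈ M, e.1 = e'.1 → e = e' := (Finset.mem_filter.mp hMmem).2.1
  have hM2 : ∀ e ∈ M, ∀ e' ∈ M, e.2 = e'.2 → e = e' := (Finset.mem_filter.mp hMmem).2.2
  -- maximality: every cell of `H` shares a row or a column with a cell of `M`
  have hcover : ∀ e ∈ H, ∃ f ∈ M, e.1 = f.1 ∨ e.2 = f.2 := by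
    intro e he
    by_contra hcon
    push Not at hcon
    have heM : e ∉ M := fun h => (hcon e h).1 rfl
    have hins : insert e M ∈ (H.powerset).filter (fun M : Finset (α × β) =>
        (∀ e ∈ M, ∀ e' ∈ M, e.1 = e'.1 → e = e') ∧
          (∀ e ∈ M, ∀ e' ∈ M, e.2 = e'.2 → e = e')) := by
      rw [Finset.mem_filter, Finset.mem_powerset]
      refine ⟨Finset.insert_subset he hMH, ?_, ?_⟩
      · intro x hx y hy hxy
        rw [Finset.mem_insert] at hx hy
        rcases hx with rfl | hx <;> rcases hy with rfl | hy
        · rfl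
        · exact absurd hxy (hcon y hy).1
        · exact absurd hxy.symm (hcon x hx).1
        · exact hM1 x hx y hy hxy
      · intro x hx y hy hxy
        rw [Finset.mem_insert] at hx hy
        rcases hx with rfl | hx <;> rcases hy with rfl | hy
        · rfl
        · exact absurd hxy (hcon y hy).2
        · exact absurd hxy.symm (hcon x hx).2
        · exact hM2 x hx y hy hxy
    have hle := hmax _ hins
    rw [Finset.card_insert_of_notMem heM] at hle
    omega
  refine ⟨M, hMH, ?_, ?_, ?_⟩
  · intro x hx y hy hxy
    exact hM1 x (Finset.mem_coe.mp hx) y (Finset.mem_coe.mp hy) hxy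
  · intro x hx y hy hxy
    exact hM2 x (Finset.mem_coe.mp hx) y (Finset.mem_coe.mp hy) hxy
  · -- double counting along the cover
    calc ∑ e ∈ H, w e
        ≤ ∑ e ∈ H, ∑ f ∈ M, (if e.1 = f.1 ∨ e.2 = f.2 then w e else 0) := by
          refine Finset.sum_le_sum fun e he => ?_
          obtain ⟨f, hf, hfe⟩ := hcover e he
          have h0 : ∀ g ∈ M, 0 ≤ (if e.1 = g.1 ∨ e.2 = g.2 then w e else 0) := by
            intro g _
            split_ifs
            · exact hw e he
            · exact le_rfl
          calc w e = (if e.1 = f.1 ∨ e.2 = f.2 then w e else 0) := by rw [if_pos hfe]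
            _ ≤ ∑ g ∈ M, (if e.1 = g.1 ∨ e.2 = g.2 then w e else 0) :=
                Finset.single_le_sum h0 hf
      _ = ∑ f ∈ M, ∑ e ∈ H, (if e.1 = f.1 ∨ e.2 = f.2 then w e else 0) := Finset.sum_comm
      _ ≤ ∑ f ∈ M, (∑ e ∈ H.filter (fun e => e.1 = f.1), w e
            + ∑ e ∈ H.filter (fun e => e.2 = f.2), w e) := by
          refine Finset.sum_le_sum fun f _ => ?_
          rw [Finset.sum_filter, Finset.sum_filter, ← Finset.sum_add_distrib]
          refine Finset.sum_le_sum fun e he => ?_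
          have hwe := hw e he
          by_cases h1 : e.1 = f.1
          · by_cases h2 : e.2 = f.2
            · rw [if_pos (Or.inl h1), if_pos h1, if_pos h2]
              linarith
            · rw [if_pos (Or.inl h1), if_pos h1, if_neg h2, add_zero]
          · by_cases h2 : e.2 = f.2
            · rw [if_pos (Or.inr h2), if_neg h1, if_pos h2, zero_add]
            · rw [if_neg (not_or.mpr ⟨h1, h2⟩), if_neg h1, if_neg h2, add_zero]
      _ ≤ ∑ f ∈ M, (τ + τ) :=
          Finset.sum_le_sum fun f _ => add_le_add (hrow f.1) (hcol f.2)
      _ = 2 * M.card * τ := by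
          rw [Finset.sum_const, nsmul_eq_mul]
          ring

end Summit.MatrixMultiplication.MatrixMultiplication.Theorems.PolynomialSlack
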